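/- Width seat `ym-line-cbag-p1-w3` (prover-ym-line-cbag-p1-w3-g0-0), route `ColdBoxAllGroups`: the Assembly item (stmt-QuantumFields-22256). -/
import Summits.QuantumFields.YangMills.Theses.ColdBoxAllGroups

/-!
# Route `ColdBoxAllGroups`, Assembly (stmt-QuantumFields-22256): `BoxFloorAllGroups → BulkAllGroups → XiPow` — PROVED

The deciding implication of the route (the planner's kernel-checked `closes` of `l1/glue.lean`, ideator `ym-idea-2`), landed as the
Assembly item: for every compact simple `G` and faithful unitary lattice representation `r`, take the exponent ceiling `θ₀` from
`BoxFloorAllGroups`, admissible exponents `(A, θ)` under that ceiling from `BulkAllGroups`, the box constant `c` from `BoxFloorAllGroups`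
at `(A, θ)`, and the tree's group-free FLOOR `curvatureCorrPowerFloor_proof` (`κ/n⁴ ≤ |C(n)|`); the generic kernel glue
`massGapPowerDecayOf_of_box` gives `MassGapPowerDecayOf 4 r.ρ (A/2)`, i.e. the rung leaf `XiPow` with `ε = A/2`.
Pure logic plus two tree theorems; no sorry; standard axioms.  `XiPow` is a RUNG LEAF strictly below the Clay statement: NOT a claim
about the Yang–Mills mass gap (RECORD label); and this file does not prove the two cruxes, only the implication.
-/

set_option autoImplicit false

namespace Summit.QuantumFields.YangMills.Theorems.ColdBoxAllGroups

open Summit.QuantumFields.YangMills.Theses.ColdBoxAllGroups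

/-- **Assembly of route `ColdBoxAllGroups`**: `BoxFloorAllGroups → BulkAllGroups → XiPow` (ceiling `θ₀` from BOX, exponents from BULK under
the ceiling, constant from BOX, floor `curvatureCorrPowerFloor_proof`, glue `massGapPowerDecayOf_of_box`; `ε = A/2`). -/
theorem assembly_proof : Summit.QuantumFields.YangMills.Theses.ColdBoxAllGroups.Assembly := by
  intro h₁ h₂ G _ _ _ _ hG
  letI : MeasurableSpace G := borel G
  haveI : BorelSpace G := ⟨rfl⟩
  show ∀ r : Literature.MathematicalPhysics.QuantumFieldTheory.LatticeRep G, ∃ ε : ℝ, 0 < ε ∧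
    Summit.QuantumFields.YangMills.Theorems.WeakCouplingRates.MassGapPowerDecayOf 4 r.ρ ε
  intro r
  have hb : ∀ r : Literature.MathematicalPhysics.QuantumFieldTheory.LatticeRep G, ∃ θ₀ : ℝ, 0 < θ₀ ∧
      ∀ A θ : ℝ, 0 < A → A < θ → θ ≤ θ₀ → ∃ c : ℝ, 0 < c ∧
        Summit.QuantumFields.YangMills.Theorems.WeakCouplingRates.BoxTwoPointDomination r.ρ A θ c := h₁ G hG
  have hk : ∀ r : Literature.MathematicalPhysics.QuantumFieldTheory.LatticeRep G, ∀ θ₀ : ℝ, 0 < θ₀ →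
      ∃ A θ : ℝ, 0 < A ∧ A < θ ∧ θ ≤ θ₀ ∧
        Summit.QuantumFields.YangMills.Theorems.WeakCouplingRates.BulkDominatesBox r.ρ A θ := h₂ G hG
  obtain ⟨θ₀, hθ₀, hbox⟩ := hb r
  obtain ⟨A, θ, hA, hAθ, hθ, hbulk⟩ := hk r θ₀ hθ₀
  obtain ⟨c, hc, hB⟩ := hbox A θ hA hAθ hθ
  have hF : ∃ κ : ℝ, 0 < κ ∧ ∃ n₀ : ℕ, ∀ n : ℕ, n₀ ≤ n → κ / (n : ℝ) ^ 4 ≤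
      |Literature.MathematicalPhysics.QuantumFieldTheory.curvaturePlaquetteCorr (d := 4) (by norm_num) (n : ℤ)| :=
    Summit.QuantumFields.YangMills.Theorems.WeakCouplingRates.curvatureCorrPowerFloor_proof
  exact ⟨A / 2, by linarith,
    Summit.QuantumFields.YangMills.Theorems.WeakCouplingRates.massGapPowerDecayOf_of_box r.ρ r.continuous hA hc hB hbulk hF⟩

end Summit.QuantumFields.YangMills.Theorems.ColdBoxAllGroups
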